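import Summits.QuantumFields.YangMills.Theorems.BalabanLadderUVSeamRecCeilingsPolymerRarityComponentsEntropy
import Summits.QuantumFields.YangMills.Theorems.BalabanLadderUVSeamRecCeilingsPolymerRarityMoments
import HarnessLib

/-!
# Crux `UVSeamRec` (stmt-QuantumFields-20043), stub `stub_ceilings` (E0′): SIZE-EXTENSIVE influence of large-field
# polymers — joint exponential moments of the component-gas carrier with an explicit β-uniform budget

Helper file (`--supports stmt-QuantumFields-20043`) of the width-lever seat `ym-20043-ceilings-p2` (lane B, gen 2); sequel of
p527372 `…CeilingsPolymerRarity.lean` (`integral_exp_mul_sum_influence_le`: joint moments of LINEAR influence functionals of a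
polymer gas under the budgets `Σ_i a_{iγ} ≤ Λ`, `Σ_γ a_{iγ} w_γ ≤ W`) and of `…ComponentsEntropy.lean` (density budget of a
connected-polymer gas, `influenceBudget_le`).  HONEST FRAMING: measure theory / combinatorics for the LARGE-FIELD CARRIER of the
(β) architecture (p535725 `responseMoments_of_quadratic_and_polymerLaw`); the cell law at Bałaban's block levels k ≥ 1 is OPEN on
odd tori (scale 0: p530009/p536610); nothing of E0′; not a gap, not Clay.

WHY.  For a gas of CONNECTED large-field regions (p536610) the natural influence coefficient of a polymer on a cube is
sub-additive over the polymer's cells, `a_{iγ} ≤ Σ_{v∈γ} κ_{i,v}`; then the one-polymer budget `Σ_i a_{iγ}` of p527372 grows like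
the SIZE `#γ`, not uniformly.  The growth is harmless: it is absorbed into the activity, `e^{λΛ₁#γ}·δ^{#γ} = (e^{λΛ₁}δ)^{#γ}`, which
is still a small-activity gas.

* §1 `integral_exp_mul_sum_influence_le_of_size` (any probability space) — p527372's joint-moment bound with a SIZE-EXTENSIVE
  one-polymer budget `Σ_{i∈T} a_{iγ} ≤ Λ₁·size γ`: `∫ exp(λ Σ_{i∈T} I_i) dμ ≤ exp(λ W′·#T)` where
  `W′ ≥ Σ_γ a_{iγ} e^{λΛ₁ size γ} w_γ`.
* §2 **`integral_exp_mul_sum_influence_le_of_components`** — for a connected-polymer gas with weights `δ^{#γ}`, cell masses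
  `κ_{i,v} ≥ 0` with `Σ_i κ_{i,v} ≤ Λ₁` (every cell) and `Σ_{v∈anchors_i} κ_{i,v} ≤ K₁` (every cube), sub-additive coefficients
  `a_{iγ} ≤ Σ_{v∈anchors_i∩γ} κ_{i,v}` supported on anchored cells, a symmetric adjacency of degree `≤ Δ` and the smallness
  `(Δ+1)²·e^{λΛ₁}δ ≤ 1/2`: `∫ exp(λ Σ_{i∈T} I_i) dμ ≤ exp(2λ e^{λΛ₁} δ K₁ · #T)` — an EXPLICIT budget, β-uniform as soon as `δ` is
  (the input (EM_K) of p535725 for the large-field carrier, at `λ = K`).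

References: folklore (Peierls / Kotecký–Preiss bookkeeping: D. Brydges, Les Houches 1984, §2; R. Kotecký, D. Preiss, Commun. Math.
Phys. 103 (1986) 491–498); S. Friedli, Y. Velenik (2017) Lemma 3.38 via the tree's `LatticeAnimals`.
-/

set_option autoImplicit false

noncomputable section

open MeasureTheory Finset
open Literature.MathematicalPhysics.QuantumLattice (integrable_of_abs_le)

namespace Summit.QuantumFields.YangMills.Cruxes.UVSeamRec.PolymerRarity

variable {Ω : Type*} [MeasurableSpace Ω] (μ : Measure Ω) [IsProbabilityMeasure μ]

/-! ## §1 Joint moments with a size-extensive one-polymer budget -/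

section Sized

variable {κ : Type*}

/-- **Joint exponential moments of linear influence functionals, size-extensive budget.**  Setting of p527372
`integral_exp_mul_sum_influence_le` (events `E_γ`, weights `w_γ ≥ 0`, product law for all sub-families, coefficients
`a_{iγ} ≥ 0`, tilt `λ ≥ 0`), but with the one-polymer budget allowed to grow with a size function,
`Σ_{i∈T} a_{iγ} ≤ Λ₁ · size γ`, and the density budget weighted accordingly, `Σ_{γ∈S} a_{iγ} e^{λΛ₁ size γ} w_γ ≤ W′` for every
cube `i ∈ T`.  Then `∫ exp(λ Σ_{i∈T} Σ_γ a_{iγ} 1_{E_γ}) dμ ≤ exp(λ W′ · #T)`.  Proof: ideal-gas domination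
(`integral_exp_sum_indicator_le_exp`), `e^t − 1 ≤ t e^t`, and `e^{t_γ} ≤ e^{λΛ₁ size γ}`. [folklore] -/
theorem integral_exp_mul_sum_influence_le_of_size {ι : Type*} (T : Finset ι) (S : Finset κ) (E : κ → Set Ω)
    (hE : ∀ γ, MeasurableSet (E γ)) (w : κ → ℝ) (hw : ∀ γ ∈ S, 0 ≤ w γ)
    (a : ι → κ → ℝ) (ha : ∀ i ∈ T, ∀ γ ∈ S, 0 ≤ a i γ) (size : κ → ℝ) {lam Λ₁ W' : ℝ} (hlam : 0 ≤ lam)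
    (hΛ : ∀ γ ∈ S, ∑ i ∈ T, a i γ ≤ Λ₁ * size γ)
    (hW : ∀ i ∈ T, ∑ γ ∈ S, a i γ * (Real.exp (lam * Λ₁ * size γ) * w γ) ≤ W')
    (hPL : ∀ A, A ⊆ S → μ.real (⋂ γ ∈ A, E γ) ≤ ∏ γ ∈ A, w γ) :
    ∫ ω, Real.exp (lam * ∑ i ∈ T, ∑ γ ∈ S, a i γ * (E γ).indicator (fun _ => (1 : ℝ)) ω) ∂μ ≤
      Real.exp (lam * W' * T.card) := by
  -- exchange the sums: the joint tilt is a polymer tilt with `t_γ = λ Σ_{i∈T} a_{iγ}`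
  have hswap : ∀ ω, lam * ∑ i ∈ T, ∑ γ ∈ S, a i γ * (E γ).indicator (fun _ => (1 : ℝ)) ω =
      ∑ γ ∈ S, (lam * ∑ i ∈ T, a i γ) * (E γ).indicator (fun _ => (1 : ℝ)) ω := by
    intro ω
    rw [Finset.sum_comm, Finset.mul_sum]
    refine Finset.sum_congr rfl fun γ _ => ?_
    rw [mul_assoc, Finset.sum_mul]
  simp_rw [hswap]
  have ht : ∀ γ ∈ S, 0 ≤ lam * ∑ i ∈ T, a i γ := fun γ hγ =>
    mul_nonneg hlam (Finset.sum_nonneg fun i hi => ha i hi γ hγ)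
  refine (integral_exp_sum_indicator_le_exp μ S E hE _ w ht hw hPL).trans (Real.exp_le_exp.2 ?_)
  have hexp : ∀ x : ℝ, Real.exp x - 1 ≤ x * Real.exp x := fun x => by
    have h2 : Real.exp x * (1 - x) ≤ Real.exp x * Real.exp (-x) :=
      mul_le_mul_of_nonneg_left (Real.one_sub_le_exp_neg x) (Real.exp_pos x).le
    rw [← Real.exp_add, add_neg_cancel, Real.exp_zero] at h2
    nlinarith
  have hΛ' : ∀ γ ∈ S, lam * ∑ i ∈ T, a i γ ≤ lam * Λ₁ * size γ := fun γ hγ => by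
    rw [mul_assoc]; exact mul_le_mul_of_nonneg_left (hΛ γ hγ) hlam
  calc ∑ γ ∈ S, (Real.exp (lam * ∑ i ∈ T, a i γ) - 1) * w γ
      ≤ ∑ γ ∈ S, ((lam * ∑ i ∈ T, a i γ) * Real.exp (lam * Λ₁ * size γ)) * w γ := by
        refine Finset.sum_le_sum fun γ hγ => mul_le_mul_of_nonneg_right ?_ (hw γ hγ)
        exact (hexp _).trans (mul_le_mul_of_nonneg_left (Real.exp_le_exp.2 (hΛ' γ hγ)) (ht γ hγ))
    _ = lam * ∑ i ∈ T, ∑ γ ∈ S, a i γ * (Real.exp (lam * Λ₁ * size γ) * w γ) := by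
        rw [Finset.sum_comm, Finset.mul_sum]
        refine Finset.sum_congr rfl fun γ _ => ?_
        rw [Finset.mul_sum, Finset.mul_sum, Finset.sum_mul, Finset.sum_mul]
        refine Finset.sum_congr rfl fun i _ => ?_
        ring
    _ ≤ lam * ∑ _i ∈ T, W' := mul_le_mul_of_nonneg_left (Finset.sum_le_sum fun i hi => hW i hi) hlam
    _ = lam * W' * T.card := by rw [Finset.sum_const, nsmul_eq_mul]; ring

end Sized

/-! ## §2 The connected-polymer gas: explicit β-uniform budget -/

section Components

variable {V : Type*} [DecidableEq V]

/-- **Joint exponential moments of the component-gas carrier, explicit budget.**  Data: a symmetric adjacency `R` on cells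
with neighbour sets of size `≤ Δ`; a finite family `S` of chain-connected polymers (finite cell sets) with events `E_γ`
obeying the product law `μ(⋂_{γ∈A} E_γ) ≤ ∏_{γ∈A} δ^{#γ}` for every `A ⊆ S` (`δ ≥ 0`; e.g. the component events of p536610);
for each cube `i ∈ T` an anchor set and cell masses `κ i v ≥ 0` with `Σ_{i∈T} κ i v ≤ Λ₁` for every cell and
`Σ_{v∈anchors i} κ i v ≤ K₁` for every cube; influence coefficients `0 ≤ a_{iγ} ≤ Σ_{v ∈ anchors i, v ∈ γ} κ i v`; a tilt
`λ ≥ 0` with the smallness `(Δ+1)² · (e^{λΛ₁} δ) ≤ 1/2`.  Then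
`∫ exp(λ Σ_{i∈T} Σ_γ a_{iγ} 1_{E_γ}) dμ ≤ exp(2λ e^{λΛ₁} δ K₁ · #T)`.
Proof: §1 with `size γ = #γ` (sub-additivity and `Σ_i κ ≤ Λ₁`), then `influenceBudget_le` for the activity `e^{λΛ₁}δ`.
For the scale-zero gas of p536610 on a radius-`R+1` cube: anchors = the shell plaquettes, `κ i v = dist(v, x_i)⁻⁴`-type,
`K₁, Λ₁ = O(1)` uniformly in `R`, so the budget is β-uniform exactly when `δ(β,ε)` is bounded by the lattice-animal
threshold — no rate, no decay in β required. [folklore] -/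
theorem integral_exp_mul_sum_influence_le_of_components {ι : Type*} (T : Finset ι) {R : V → V → Prop}
    (hR : ∀ x y, R x y → R y x) {nbr : V → Finset V} {Δ : ℕ} (hΔ : ∀ x, (nbr x).card ≤ Δ)
    (hnbr : ∀ x y, R x y → y ∈ nbr x) (S : Finset (Finset V))
    (hS : ∀ γ ∈ S, ∃ b ∈ γ, ∀ w ∈ γ, Relation.ReflTransGen (fun x y => R x y ∧ x ∈ γ ∧ y ∈ γ) b w)
    (E : Finset V → Set Ω) (hE : ∀ γ, MeasurableSet (E γ)) {δ : ℝ} (hδ : 0 ≤ δ)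
    (hPL : ∀ A, A ⊆ S → μ.real (⋂ γ ∈ A, E γ) ≤ ∏ γ ∈ A, δ ^ γ.card)
    (anchors : ι → Finset V) (κ : ι → V → ℝ) (hκ : ∀ i ∈ T, ∀ v, 0 ≤ κ i v) {Λ₁ K₁ lam : ℝ}
    (hΛ₁ : ∀ v, ∑ i ∈ T, κ i v ≤ Λ₁) (hK₁ : ∀ i ∈ T, ∑ v ∈ anchors i, κ i v ≤ K₁)
    (a : ι → Finset V → ℝ) (ha : ∀ i ∈ T, ∀ γ ∈ S, 0 ≤ a i γ)
    (hsub : ∀ i ∈ T, ∀ γ ∈ S, a i γ ≤ ∑ v ∈ (anchors i).filter (fun v => v ∈ γ), κ i v)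
    (hlam : 0 ≤ lam) (hsmall : ((Δ : ℝ) + 1) ^ 2 * (Real.exp (lam * Λ₁) * δ) ≤ 1 / 2) :
    ∫ ω, Real.exp (lam * ∑ i ∈ T, ∑ γ ∈ S, a i γ * (E γ).indicator (fun _ => (1 : ℝ)) ω) ∂μ ≤
      Real.exp (lam * (2 * (Real.exp (lam * Λ₁) * δ) * K₁) * T.card) := by
  set δ' : ℝ := Real.exp (lam * Λ₁) * δ with hδ'
  have hδ'0 : 0 ≤ δ' := mul_nonneg (Real.exp_pos _).le hδ
  -- one-polymer budget, size-extensive (sub-additivity and `Σ_i κ ≤ Λ₁`)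
  have hΛ : ∀ γ ∈ S, ∑ i ∈ T, a i γ ≤ Λ₁ * (γ.card : ℝ) := by
    intro γ hγ
    calc ∑ i ∈ T, a i γ ≤ ∑ i ∈ T, ∑ v ∈ (anchors i).filter (fun v => v ∈ γ), κ i v :=
          Finset.sum_le_sum fun i hi => hsub i hi γ hγ
      _ ≤ ∑ i ∈ T, ∑ v ∈ γ, κ i v := by
          refine Finset.sum_le_sum fun i hi => Finset.sum_le_sum_of_subset_of_nonneg
            (fun v hv => (Finset.mem_filter.1 hv).2) fun v _ _ => hκ i hi v
      _ = ∑ v ∈ γ, ∑ i ∈ T, κ i v := Finset.sum_comm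
      _ ≤ ∑ _v ∈ γ, Λ₁ := Finset.sum_le_sum fun v _ => hΛ₁ v
      _ = Λ₁ * (γ.card : ℝ) := by rw [Finset.sum_const, nsmul_eq_mul]; ring
  -- the activity absorbs the size-extensive tilt: `e^{λΛ₁#γ} δ^{#γ} = δ'^{#γ}`
  have hact : ∀ γ : Finset V, Real.exp (lam * Λ₁ * (γ.card : ℝ)) * δ ^ γ.card = δ' ^ γ.card := fun γ => by
    rw [hδ', mul_pow, ← Real.exp_nat_mul]
    congr 2
    ring
  -- density budget for the activity `δ'` (entropy sum of `…ComponentsEntropy`)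
  have hW : ∀ i ∈ T, ∑ γ ∈ S, a i γ * (Real.exp (lam * Λ₁ * (γ.card : ℝ)) * δ ^ γ.card) ≤ 2 * δ' * K₁ := by
    intro i hi
    simp_rw [hact]
    calc ∑ γ ∈ S, a i γ * δ' ^ γ.card ≤ 2 * δ' * ∑ v ∈ anchors i, κ i v :=
          influenceBudget_le hR hΔ hnbr S hS hδ'0 hsmall (anchors i) (κ i) (fun v _ => hκ i hi v) (a i)
            (fun γ hγ => hsub i hi γ hγ)
      _ ≤ 2 * δ' * K₁ := mul_le_mul_of_nonneg_left (hK₁ i hi) (by positivity)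
  -- conclude by §1 with `size γ = #γ`, `W′ = 2δ′K₁`
  exact integral_exp_mul_sum_influence_le_of_size μ T S E hE (fun γ => δ ^ γ.card) (fun γ _ => pow_nonneg hδ _)
    a ha (fun γ => (γ.card : ℝ)) hlam hΛ hW hPL

end Components

end Summit.QuantumFields.YangMills.Cruxes.UVSeamRec.PolymerRarity

end
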